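import Literature.IUT.HodgeArakelov.Cor4546SubdagStatements
import HarnessLib

/-!
# [IUTchII] Proposition 4.1 (iii): the symmetrizing isomorphisms and diagonal submonoids are
# "compatible with the respective actions by subscripted versions of `G_v(Π_v)`" (discharge companion)

Proof-only companion (abc-iut cell, layer L6, wave-4 discharge seat abc-iut-w4-d005 gen 4; node
**IUTchII:Prop4.1(iii)**; also the identical clauses of **IUTchII:Prop4.3(iii)** p. 128 and **IUTchII:Cor3.5(i)**
p. 94) of abc-iut-L6-t2's `GaussianMonoidsGood.lean` (p404520: `diagonalSubmonoid`, `diagonalEmbedding`,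
`diagonalIso`) and abc-iut-w5-d118's `Cor4546SubdagStatements.lean` (p414022: `SymmetrizingIsos`, `.diagonal`,
`.toDiagonal`, `.diagonalIso`, `.ofCopies`; p414584 lineage: `ActionTransport`). NO new definitions.

S. Mochizuki, *Inter-universal Teichmüller theory II*, kurims manuscript (Dec. 2020), Proposition 4.1 (iii),
p. 121 l. 27 – p. 122 l. 2 [claim key Mochizuki2012, status disputed (D-0012)], read on the cell render
`lit/renders/IUTchII-kurims-url-5036b4059555`: "the `Δ^±_v`-outer action of `𝔽_l^{⋊±} ≅ Δ^cor_v/Δ^±_v` on `Π^±_v` …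
induces isomorphisms between the pairs `G_v(Π_v)_t ↷ Ψ_cns(Π_v)_t` — consisting of a labeled ind-topological
monoid equipped with the action of a labeled topological group — for distinct `t ∈ LabCusp^±(Π_v)`. We shall
refer to these isomorphisms as [`𝔽_l^{⋊±}`-]symmetrizing isomorphisms … These symmetrizing isomorphisms determine
diagonal submonoids `Ψ_cns(Π_v)_⟨|𝔽_l|⟩ ⊆ ∏_{|t| ∈ |𝔽_l|} Ψ_cns(Π_v)_{|t|}`; `Ψ_cns(Π_v)_⟨𝔽_l^⋇⟩ ⊆ ∏_{|t| ∈ 𝔽_l^⋇} Ψ_cns(Π_v)_{|t|}`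
of the respective product monoids compatible with the respective actions by subscripted versions of
`G_v(Π_v)` …, as well as an isomorphism of ind-topological monoids `Ψ_cns(Π_v)_0 ⥲ Ψ_cns(Π_v)_⟨𝔽_l^⋇⟩` compatible
with the respective actions by subscripted versions of `G_v(Π_v)`".

WHAT IS PROVED. The printed symmetrizing isomorphisms are isomorphisms of PAIRS (group ↷ monoid); abc-iut-w5-d118's
`SymmetrizingIsos` records the monoid isomorphisms `σ_{t,t'}`. Given, for every label `t`, an action of (a copy of)
one group `Γ` on `Ψ_t` such that every `σ_{t,t'}` is `Γ`-equivariant — the inline hypothesis `hσ`, which is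
what "isomorphisms between the pairs" says, and which holds DEFINITIONALLY for the literal labeled copies of ONE
pair `G_v(Π_v) ↷ Ψ_cns(Π_v)` (`isEquivariant_ofCopies`, the typing of p404520) and for isomorphisms induced by
transport of structure — the three printed compatibilities hold:
* `SymmetrizingIsos.act_mem_diagonal` — the diagonal submonoid `Ψ_⟨S⟩ ⊆ ∏_{s ∈ S} Ψ_{e(s)}` is stable under the
  simultaneous ("subscripted") action of `Γ` ("diagonal submonoids … compatible with the respective actions");
* `SymmetrizingIsos.toDiagonal_act`, `SymmetrizingIsos.coe_diagonalIso_act` — the isomorphism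
  `Ψ_{t₀} ⥲ Ψ_⟨S⟩` (print: `Ψ_cns(Π_v)_0 ⥲ Ψ_cns(Π_v)_⟨𝔽_l^⋇⟩`) is `Γ`-equivariant ("compatible with the respective
  actions by subscripted versions of `G_v(Π_v)`");
* for abc-iut-L6-t2's literal kernel: `diagonalSubmonoid_map_mem`, `diagonalEmbedding_map`,
  `coe_diagonalIso_map` — the same three statements for `diagonalSubmonoid` / `diagonalEmbedding` /
  `diagonalIso` and ANY self-map applied in every coordinate (in particular the action of any `γ ∈ G_v(Π_v)`),
  and `ofCopies_iso_act` — the symmetrizing isomorphisms of literal copies commute with every such map.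

HONEST SCOPE: the INPUT of Prop. 4.1 (iii) — that the `Δ^±_v`-outer `𝔽_l^{⋊±}`-action on `Π^±_v` at `v ∈ 𝕍^good ∩ 𝕍^non`
induces isomorphisms of pairs (slot `GoodPlaceReconstructionStatements.symmetrizing`, p404520; [IUTchI] Def. 6.1,
Cor. 2.4 (iii) analogue) — is not constructed here; what is certified is that ONCE the symmetrizing isomorphisms
are isomorphisms of pairs, every "compatible with the respective actions" clause of (iii) follows, and that for
the cell's literal-copies kernel they hold with no hypothesis. Nothing here takes a side on [IUTchIII] Cor. 3.12;
typed ≠ endorsed.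
-/

namespace Literature.IUT.HodgeArakelov

universe u v w u'

/-! ### 1. Equivariance for a general system of symmetrizing isomorphisms -/

namespace SymmetrizingIsos

variable {T : Type u} {Ψ : T → Type v} [∀ t, CommMonoid (Ψ t)] (σ : SymmetrizingIsos Ψ)
variable {Γ : Type u'} (act : ∀ t : T, Γ → Ψ t → Ψ t)

/- HYPOTHESIS SHAPE used below ("isomorphisms between the PAIRS `G_v(Π_v)_t ↷ Ψ_cns(Π_v)_t`", Prop. 4.1 (iii)
p. 121 l. 33–36): `hσ : ∀ t t' γ x, σ.iso t t' (act t γ x) = act t' γ (σ.iso t t' x)` — the symmetrizing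
isomorphisms intertwine the (subscripted copies of the) Galois action. Stated inline (no new definition). -/

/-- **IUTchII:Prop4.1(iii)** (kurims p. 121 l. 38–44, "diagonal submonoids … compatible with the respective actions
by subscripted versions of `G_v(Π_v)`"): if the symmetrizing isomorphisms are isomorphisms of pairs, the diagonal
submonoid `Ψ_⟨S⟩ ⊆ ∏_{s ∈ S} Ψ_{e(s)}` is stable under the simultaneous action of every `γ`.
[claim: Mochizuki2012, status: disputed] -/
theorem act_mem_diagonal (hσ : ∀ (t t' : T) (γ : Γ) (x : Ψ t), σ.iso t t' (act t γ x) = act t' γ (σ.iso t t' x)) {S : Type w} (e : S → T) (γ : Γ)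
    {x : ∀ s : S, Ψ (e s)} (hx : x ∈ σ.diagonal e) : (fun s => act (e s) γ (x s)) ∈ σ.diagonal e := by
  intro s s'
  show σ.iso (e s) (e s') (act (e s) γ (x s)) = act (e s') γ (x s')
  rw [hσ, hx s s']

/-- **IUTchII:Prop4.1(iii)** (kurims p. 121 l. 44 – p. 122 l. 2, "an isomorphism … `Ψ_cns(Π_v)_0 ⥲ Ψ_cns(Π_v)_⟨𝔽_l^⋇⟩`
compatible with the respective actions by subscripted versions of `G_v(Π_v)`"): the map `Ψ_{t₀} → Ψ_⟨S⟩` is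
`Γ`-equivariant for the simultaneous action on the target. [claim: Mochizuki2012, status: disputed] -/
theorem toDiagonal_act (hσ : ∀ (t t' : T) (γ : Γ) (x : Ψ t), σ.iso t t' (act t γ x) = act t' γ (σ.iso t t' x)) {S : Type w} (e : S → T) (t₀ : T) (γ : Γ) (m : Ψ t₀) :
    σ.toDiagonal e t₀ (act t₀ γ m) = fun s => act (e s) γ (σ.toDiagonal e t₀ m s) := by
  funext s
  rw [toDiagonal_apply, toDiagonal_apply, hσ]

/-- **IUTchII:Prop4.1(iii)** (kurims p. 121 l. 44 – p. 122 l. 2): the same for the ISOMORPHISM onto the diagonal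
(`diagonalIso`, nonempty index set), at the level of the underlying families.
[claim: Mochizuki2012, status: disputed] -/
theorem coe_diagonalIso_act (hσ : ∀ (t t' : T) (γ : Γ) (x : Ψ t), σ.iso t t' (act t γ x) = act t' γ (σ.iso t t' x)) {S : Type w} [Nonempty S] (e : S → T) (t₀ : T) (γ : Γ)
    (m : Ψ t₀) :
    ((σ.diagonalIso e t₀ (act t₀ γ m) : σ.diagonal e) : ∀ s : S, Ψ (e s)) =
      fun s => act (e s) γ (((σ.diagonalIso e t₀ m : σ.diagonal e) : ∀ s : S, Ψ (e s)) s) := by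
  funext s
  rw [coe_diagonalIso_apply, coe_diagonalIso_apply, hσ]

/-- **IUTchII:Prop4.1(iii)** (kurims p. 121): the inverse direction — evaluating a diagonal family at a label and
transporting back to `t₀` is `Γ`-equivariant as well. [claim: Mochizuki2012, status: disputed] -/
theorem iso_eval_act (hσ : ∀ (t t' : T) (γ : Γ) (x : Ψ t), σ.iso t t' (act t γ x) = act t' γ (σ.iso t t' x)) {S : Type w} (e : S → T) (t₀ : T) (γ : Γ) (s : S)
    (x : ∀ s : S, Ψ (e s)) : σ.iso (e s) t₀ (act (e s) γ (x s)) = act t₀ γ (σ.iso (e s) t₀ (x s)) :=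
  hσ (e s) t₀ γ (x s)

/-- **IUTchII:Prop4.1(iii)** (kurims p. 121 l. 33–37): for the LITERAL labeled copies of one pair `Γ ↷ M`
(abc-iut-L6-t2's typing: `Ψ_cns(Π_v)_t := Ψ_cns(Π_v)` for every `t`, symmetrizing isomorphisms = identities,
`SymmetrizingIsos.ofCopies`), the symmetrizing isomorphisms ARE isomorphisms of pairs for ANY family of self-maps
that is the same map on every copy ("subscripted versions" of one action) — no hypothesis.
[claim: Mochizuki2012, status: disputed] -/
theorem isEquivariant_ofCopies (T : Type u) (M : Type v) [CommMonoid M] {Γ : Type u'} (ρ : Γ → M → M) :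
    ∀ (t t' : T) (γ : Γ) (x : M), (ofCopies T M).iso t t' (ρ γ x) = ρ γ ((ofCopies T M).iso t t' x) :=
  fun _ _ _ _ => rfl

/-- **IUTchII:Prop4.1(iii)** (kurims p. 121): for literal copies, `σ_{t,t'}(γ·m) = γ·σ_{t,t'}(m)` on the nose.
[claim: Mochizuki2012, status: disputed] -/
theorem ofCopies_iso_act (T : Type u) (M : Type v) [CommMonoid M] {Γ : Type u'} (ρ : Γ → M → M) (t t' : T)
    (γ : Γ) (m : M) : (ofCopies T M).iso t t' (ρ γ m) = ρ γ ((ofCopies T M).iso t t' m) := rfl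

end SymmetrizingIsos

/-! ### 2. The literal kernel of abc-iut-L6-t2 (`diagonalSubmonoid`, `diagonalEmbedding`, `diagonalIso`) -/

section Literal

variable {T : Type u} {M : Type v} [CommMonoid M]

/-- **IUTchII:Prop4.1(iii)** (kurims p. 121 l. 38–44, "diagonal submonoids … compatible with the respective
actions by subscripted versions of `G_v(Π_v)`") for abc-iut-L6-t2's `diagonalSubmonoid`: applying one self-map
of `Ψ_cns(Π_v)` (e.g. the action of any `γ ∈ G_v(Π_v)`) in every coordinate preserves the diagonal — no hypothesis.
[claim: Mochizuki2012, status: disputed] -/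
theorem diagonalSubmonoid_map_mem (f : M → M) {x : T → M} (hx : x ∈ diagonalSubmonoid T M) :
    (fun t => f (x t)) ∈ diagonalSubmonoid T M := by
  rw [mem_diagonalSubmonoid] at hx ⊢
  intro t t'
  rw [hx t t']

/-- **IUTchII:Prop4.1(iii)** (kurims p. 121 l. 44 – p. 122 l. 2): abc-iut-L6-t2's diagonal embedding
`Ψ_cns(Π_v)_0 → ∏ Ψ_cns(Π_v)_{|t|}` commutes with every self-map applied coordinatewise ("compatible with the
respective actions by subscripted versions of `G_v(Π_v)`"). [claim: Mochizuki2012, status: disputed] -/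
theorem diagonalEmbedding_map (f : M → M) (m : M) :
    diagonalEmbedding T M (f m) = fun t => f (diagonalEmbedding T M m t) := rfl

/-- **IUTchII:Prop4.1(iii)** (kurims p. 121 l. 44 – p. 122 l. 2): the same for abc-iut-L6-t2's ISOMORPHISM
`diagonalIso : Ψ_cns(Π_v)_0 ⥲ Ψ_cns(Π_v)_⟨T⟩` (nonempty label set), on underlying families.
[claim: Mochizuki2012, status: disputed] -/
theorem coe_diagonalIso_map [Nonempty T] (f : M → M) (m : M) :
    ((diagonalIso T M (f m) : diagonalSubmonoid T M) : T → M) =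
      fun t => f (((diagonalIso T M m : diagonalSubmonoid T M) : T → M) t) := by
  rfl

/-- **IUTchII:Prop4.1(iii)** (kurims p. 121) for a genuine group action `Γ ↷ Ψ_cns(Π_v)` (Mathlib `MulAction`):
the diagonal submonoid is stable under the simultaneous action `γ • x := (γ • x_t)_t`.
[claim: Mochizuki2012, status: disputed] -/
theorem smul_mem_diagonalSubmonoid {Γ : Type u'} [SMul Γ M] (γ : Γ) {x : T → M}
    (hx : x ∈ diagonalSubmonoid T M) : γ • x ∈ diagonalSubmonoid T M :=
  diagonalSubmonoid_map_mem (fun m => γ • m) hx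

/-- **IUTchII:Prop4.1(iii)** (kurims p. 121) for a genuine action: the diagonal embedding is equivariant,
`Δ(γ • m) = γ • Δ(m)`. [claim: Mochizuki2012, status: disputed] -/
theorem diagonalEmbedding_smul {Γ : Type u'} [SMul Γ M] (γ : Γ) (m : M) :
    diagonalEmbedding T M (γ • m) = γ • diagonalEmbedding T M m := rfl

end Literal

/-! ### 3. Via transport of structure (`ActionTransport`): symmetrizing isomorphisms induced by a synchronized
action are isomorphisms of pairs as soon as each transport is -/

namespace ActionTransport

variable {G : Type u'} [Group G] {T : Type u} [MulAction G T] {Ψ : T → Type v} [∀ t, CommMonoid (Ψ t)]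
  (A : ActionTransport G Ψ) {Γ : Type w} (act : ∀ t : T, Γ → Ψ t → Ψ t)

/-- **IUTchII:Prop4.1(iii)** / Cor. 4.5 (iii) (kurims p. 121 / p. 132): if every transport isomorphism of a
synchronized `𝔽_l^{⋊±}`-action is `Γ`-equivariant (transport of the PAIR `G_v(Π_v)_t ↷ Ψ_cns(Π_v)_t`), then the induced
system of symmetrizing isomorphisms (`toSymmetrizingIsos`, p414584) consists of isomorphisms of pairs — so §1
applies to it. [claim: Mochizuki2012, status: disputed] -/
theorem isEquivariant_toSymmetrizingIsos [MulAction.IsPretransitive G T]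
    (hA : ∀ (g : G) (t t' : T) (h : g • t = t') (γ : Γ) (x : Ψ t),
      A.act g t t' h (act t γ x) = act t' γ (A.act g t t' h x)) :
    ∀ (t t' : T) (γ : Γ) (x : Ψ t),
      (A.toSymmetrizingIsos).iso t t' (act t γ x) = act t' γ ((A.toSymmetrizingIsos).iso t t' x) := by
  intro t t' γ x
  obtain ⟨g, hg⟩ := MulAction.exists_smul_eq G t t'
  rw [A.toSymmetrizingIsos_iso_apply g t t' hg, A.toSymmetrizingIsos_iso_apply g t t' hg, hA]

end ActionTransport

end Literature.IUT.HodgeArakelov
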